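import Summits.QuantumFields.BalabanUV.T4Continuum.Support.B13StepOfRecordSubstrateShiftLetters
import Summits.QuantumFields.BalabanUV.T4Continuum.Support.B13StepOfRecordSecantStructuralUniform

/-!
# NE5 ∕ U3 — E8[rec] AT THE SUBSTRATE's **COV-SHIFTED** SLOTS OF RECORD: the structural secant END of record (p214566 → R20 re-point p217039 →
# η-uniform p219431 → substrate instance p221190) RE-POINTED at `S₀ := SubstrateSlotsOfRecordShift.slotsOfRecordShift …` (substrate-p1, W-21 = L-E15,
# p234583; NE5 owner RULINGS R53 ∕ R54, located typing point F-ne5p1-g37-1, substrate-typer Q-S18 ∕ (ν1)) on R20's operator carrier OF RECORD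
# `M := B13OpMeasurable.measOp`, with the END-face binders that the instance settles DISCHARGED BY NAME (leaf-08's `B13StepOfRecordSubstrateShiftLetters`,
# the ONE home of p221190 §1 ∕ §2 at the shifted slots — journal l.20449 ∕ l.20460 «GO (b′)»), every other binder displayed VERBATIM

Cell `pub-balaban`, unit `b2b-balaban-t4-ne5-formalise-leaf-01` (NE5 formalisation swarm, LEAF PROVER 01, gen 19).  A FOLLOWER of this lineage's
E8[rec] faces (p217039 `…Sub.ne5_of_record_restrict_secant_structural`, p219431 `…Uniform.uniform_ne5_of_record_restrict_secant_structural`, p221190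
`B13StepOfRecordSubstrate` §3 ∕ §4 at the UNSHIFTED slots) consuming substrate-p1's `SubstrateSlotsOfRecordShift.slotsOfRecordShift` (p234583) and
leaf-08-g13's three letter lemmas `opA_mem_measOp_slotsOfRecordShift` ∕ `opB_mem_measOp_slotsOfRecordShift` ∕ `transportReads_slotsOfRecordShift_of_factor`
BY NAME; GENERATED MECHANICALLY from the tree bytes of p221190 §3 ∕ §4 (`slotsOfRecord … ↦ slotsOfRecordShift …`, the three letter lemmas ↦ their
shifted twins, `rawBOfRecord ι D … ↦ rawBOfRecordShift D ι …` inside `hbdB`; generator `gen_shift1.py` in the unit's HOME dir); nothing landed is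
edited — p221190 STAYS in the tree as the record of the unshifted instance (R54 (4): the F-ne5p1-g37-1 flag is lifted by RE-POINTING, not by prose);
0 `def`, 0 cite tag (Summits-side NEW WORK under the LEAN PLACEMENT RULE — cell bookkeeping).
WHY THE SHIFT (R53 ∕ R54 ∕ W-21, verbatim in substance): at the UNSHIFTED slots run B's covariance slot at aligned index `k` reads the SAME depth as
run A's, so the W1 reading pair `ReadsTowerCovA ∧ ReadsTowerCovB` of the E1 ENDs is jointly inhabitable only by towers whose level increment on read
entries is the `ΓB`-vs-`ΓA` letter variation (level-CONSTANT at common `Γ`; kernel fact K8, journal l.19805) — NOT rows NE2 ∧ NE3's towers; at the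
SHIFTED slots run B's `.cov` reads its tower of record ONE LEVEL DEEPER (`covAtOfRecord (P (K+1)) … U (k+1)`), and the pair is inhabited by the
substrate's own one-datum tower on the window `k ≤ K` (W-21 §3 `readsTowerCovB_shift` ∕ `readsTowerCovA_record_of_le`).  THIS module is W1-FREE
(`hwer` displayed); the W1-produced twin at the shifted slots is the follower `B13StepOfRecordSubstrateShiftBalaban[Uniform]` (W-21b consumer).
HONEST FRAMING: rung (B)+1 of the FINITE-VOLUME T⁴ continuum programme — NOT infinite volume, NOT a mass gap, NOT the Clay problem, and
**NOT A PROOF OF NE5**: every analytic input of E8[rec] (row NE2's entry-currency rate `WeightedEntrywiseRate`, the one-run sizes `RawBounded`,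
the quoted levels `DecayBound`, the slice budgets, the insertion-operator structure `InsOpComposition` + membership + `InsOpRate`, the W2-op
binder `ActOpFibre` with its decay split + (2.38) shape, the history-side `ActExpLinearOn`∕`ActExpNormBound`∕`ActAbsBound` with decay split +
(2.38) shape, radii, numerics) stays a DISPLAYED HYPOTHESIS ABOUT THE SUBSTRATE's LETTERS (`SlotLetters`) at the shifted slots; nothing printed is
asserted and the substrate's instance is NOT claimed to satisfy any of them.  WHAT THE MODULE STATES (decls, not adjectives):
* §1 **`ne5_of_substrateShift_restrict_secant_structural`** — E8[rec] (p217039 §3) AT THE SHIFTED INSTANCE: `hMA`∕`hMB` REPLACED by the Letters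
  module's six letter conditions (`hbdB` = format-boundedness of the SHIFTED raw record `rawBOfRecordShift D ι c a s L.ΓB L.dkB L.gcB L.pQB L.pRB`),
  `hT` by its factorisation datum `(iopAt, hiopA)`, the scalar letters read off `L` (`rOp`, `rHist`, `ins.ω` — UNCHANGED by the (α) cov-only shift,
  W-21 §2's `rfl` views), every other binder VERBATIM; conclusion LITERALLY `NE5 (B13StepOfRecord.outA (slotsOfRecordShift …) E₀ cB)
  (B13StepOfRecord.outB (slotsOfRecordShift …) E₀ cB) W κ θ′ C₅`, p214566's `C₅` VERBATIM — the E8[rec] twin of the cores road's shifted record face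
  (leaf-08-g13 `B13AssemblyCoresEndSubstrateShift[MeasOp]`) and of the E9 road's (leaf-03-g16 `B13StepEnvelopeEndSubstrateShift`).
* §2 **`uniform_ne5_of_substrateShift_restrict_secant_structural`** — the η-UNIFORM form (p219431 §2 at the shifted instance): ONE constant for EVERY
  driven two-run object `D`, representation `ι`, letters `c a s`, frame `P`, factor index data and EVERY letter package `L` with `L.ins.ω = ω`.
CENSUS vs p221190 §3 ∕ §4 (binders, by name): MINUS = ∅; PLUS = ∅; TYPE changes: the instance `slotsOfRecord ↦ slotsOfRecordShift` throughout and
`rawBOfRecord ι D ↦ rawBOfRecordShift D ι` inside `hbdB` — nothing else.  HONEST DEPENDENCY (cell line, verbatim): continuum YM on T⁴ ⇐ BetaPertH ∧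
nine spine estimates (0/9 proved); BetaPertH ⇐ (D1) ∧ (D4) ∧ CAP+tail; G-an2-4 gates asym, D1 and NE2/3/4.  0 sorry; axioms ⊆ {propext,
Classical.choice, Quot.sound}.
-/

noncomputable section

open Metric Set MeasureTheory

namespace Summit.QuantumFields.BalabanUV.T4Continuum.B13StepOfRecordSubstrateShift

open Literature.MathematicalPhysics.QuantumFieldTheory.Balaban1983to89
open Literature.MathematicalPhysics.QuantumFieldTheory.Balaban1983to89.T4OutputRate (DecayBound NE5)
open Literature.MathematicalPhysics.QuantumFieldTheory.Balaban1983to89.T4InputCauchyRateSpecies (ballClass)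
open Literature.MathematicalPhysics.QuantumFieldTheory.Balaban1983to89.B5Prop11Plancherel (Tor)
open Summit.QuantumFields.BalabanUV.T4Continuum.B13Carriers (TwoRuns)
open Summit.QuantumFields.BalabanUV.T4Continuum.B13OpDatum (OpDatum Species FormatBounded B13Weights)
open Summit.QuantumFields.BalabanUV.T4Continuum.B13OpDatumJunctions (opOf RawBounded WeightedEntrywiseRate)
open Summit.QuantumFields.BalabanUV.T4Continuum.B13OpMeasurable (measOp)
open Summit.QuantumFields.BalabanUV.T4Continuum.B13HistMeasurable (MeasPotFrame B13HistM)
open Summit.QuantumFields.BalabanUV.T4Continuum.B13StepTermLabels (InnerLabel)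
open Summit.QuantumFields.BalabanUV.T4Continuum.B13StepTermFamily (ActData ActExpLinearOn)
open Summit.QuantumFields.BalabanUV.T4Continuum.B13StepTermSocket (labelsIndexing)
open Summit.QuantumFields.BalabanUV.T4Continuum.B13InnerData (Bnd b13InnerData)
open Summit.QuantumFields.BalabanUV.T4Continuum.UrsellTermBudget (actSum)
open Summit.QuantumFields.BalabanUV.T4Continuum.B13TermHistSecant (ActExpNormBound ActAbsBound)
open Summit.QuantumFields.BalabanUV.T4Continuum.B13DomainGeometryTR (domainGeometry)
open Summit.QuantumFields.BalabanUV.T4Continuum.B13Base (selfCtr)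
open Summit.QuantumFields.BalabanUV.T4Continuum.B13StepOfRecord (Slots assembly step)
open Summit.QuantumFields.BalabanUV.T4Continuum.OutputRateActOpFibre (ActOpFibre)
open Summit.QuantumFields.BalabanUV.T4Continuum.OutputRateInsertionStructural (InsOpComposition)
open Summit.QuantumFields.BalabanUV.T4Continuum.B13StepOfRecordSub (assemblyOn stepOn restrict)
open Summit.QuantumFields.BalabanUV.T4Continuum.B13StepOfRecordSecantStructuralSub (ne5_of_record_restrict_secant_structural)
open Summit.QuantumFields.BalabanUV.T4Continuum.B13StepOfRecordSecantStructuralUniform (uniform_ne5_of_record_restrict_secant_structural)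
open Summit.QuantumFields.BalabanUV.T4Continuum.SubstrateBackgroundTransporters (unitMod)
open Summit.QuantumFields.BalabanUV.T4Continuum.SubstrateTwoRunsDriven (DrivenRuns)
open Summit.QuantumFields.BalabanUV.T4Continuum.SubstrateRawSpecies (rawAOfRecord)
open Summit.QuantumFields.BalabanUV.T4Continuum.SubstrateSlotsOfRecord (SpeciesRec SlotLetters)
open Summit.QuantumFields.BalabanUV.T4Continuum.SubstrateSlotsOfRecordShift (rawBOfRecordShift slotsOfRecordShift)
open Summit.QuantumFields.BalabanUV.T4Continuum.B13StepOfRecordSubstrateShiftLetters (opA_mem_measOp_slotsOfRecordShift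
  opB_mem_measOp_slotsOfRecordShift transportReads_slotsOfRecordShift_of_factor)

section Shifted

variable {G : Type} [GaugeGroup G] (D : DrivenRuns G)
variable {o : Type} [Fintype o] [DecidableEq o] (ι : G →* Matrix o o ℂ) (c : ℂ) (a : ℝ) (s : ℕ → ℂ)
variable {T ι' S Ω 𝒴 : Type} (P : MeasPotFrame D.carriers) {IOp : Type*}
  (𝒵 : D.carriers.Dom → InnerLabel D.carriers.Dom (Bnd D.toTwoRuns) → Type) [∀ Z j, Fintype (𝒵 Z j)] (dom : ∀ Z j, 𝒵 Z j → D.carriers.Dom)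
  (Jc : D.carriers.Dom → InnerLabel D.carriers.Dom (Bnd D.toTwoRuns) → Type) [∀ Z j, Fintype (Jc Z j)]
  (V : D.carriers.Dom → InnerLabel D.carriers.Dom (Bnd D.toTwoRuns) → Type) [∀ Z j, NormedAddCommGroup (V Z j)]
  [∀ Z j, InnerProductSpace ℝ (V Z j)] [∀ Z j, MeasurableSpace (V Z j)] [∀ Z j, BorelSpace (V Z j)] [∀ Z j, FiniteDimensional ℝ (V Z j)]
  (mI : D.carriers.Dom → InnerLabel D.carriers.Dom (Bnd D.toTwoRuns) → Type) [∀ Z j, Fintype (mI Z j)] [∀ Z j, DecidableEq (mI Z j)]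
variable (L : SlotLetters D (o := o) (T := T) (ι' := ι') (S := S) (Ω := Ω) (𝒴 := 𝒴) P (IOp := IOp) 𝒵 dom Jc V mI)

/-! ## §1 E8[rec] structural AT THE SUBSTRATE's COV-SHIFTED SLOTS OF RECORD on the measurable operator carrier -/

section Instance

variable [MeasurableSpace Ω] [NormedAddCommGroup IOp] [NormedSpace ℂ IOp]

/-- [folklore] **E8[rec] (STRUCTURAL SECANT END OF RECORD) AT THE SUBSTRATE's COV-SHIFTED O1 INSTANCE** — p217039 §3
`ne5_of_record_restrict_secant_structural` at `S₀ := slotsOfRecordShift D ι c a s P 𝒵 dom Jc V mI L` (W-21), `M := measOp`: the membership side conditions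
from the Letters module's six LETTER conditions (`hbdB` about the SHIFTED raw record `rawBOfRecordShift D ι …`), the L01 reading from its factorisation
datum `(iopAt, hiopA)`, margins and age damping read off the letters (`L.rOp`, `L.rHist`, `L.ins.ω`); EVERY OTHER BINDER of p217039 §3 VERBATIM at the
shifted instance (= p221190 §3's with `slotsOfRecord ↦ slotsOfRecordShift`); conclusion LITERALLY `NE5 (B13StepOfRecord.outA (slotsOfRecordShift …) E₀ cB)
(B13StepOfRecord.outB (slotsOfRecordShift …) E₀ cB) W κ θ′ C₅`, p214566's `C₅` VERBATIM.  NOT a proof of NE5; nothing of the substrate's letters is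
asserted; `hwer` (W1) is DISPLAYED here — at the shifted slots its cov component is rows NE2 ∧ NE3's two-level tower rate (R53 (3)), produced by nobody
in this module. -/
theorem ne5_of_substrateShift_restrict_secant_structural (E₀ cB : ℝ) {W : Set (ℕ → ℝ)} {ROp RHist : ℕ → ℝ}
    {N A A' Aop Aop' : ℕ → (ℕ → ℝ) → D.toTwoRuns.carriers.BgB → D.toTwoRuns.carriers.Dom →
      InnerLabel D.toTwoRuns.carriers.Dom (Bnd D.toTwoRuns) → ℝ}
    {Dt : ActData D.toTwoRuns.carriers.Dom (InnerLabel D.toTwoRuns.carriers.Dom (Bnd D.toTwoRuns))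
      (measOp T ((Tor (unitMod (D.F.P D.K)) × Fin (D.F.P D.K).d) × o) ι' Ω 𝒴) (B13HistM P) Ω}
    {κ Nbar ε εop Rt EA₀ E₁ cA c₁ r₀ Gi δI ρ₁ θ θ' ρ₀ B : ℝ} {k₀ k₁ : ℕ} (rI : ℕ → ℝ) (hrI : ∀ k, 0 < rI k)
    {Cfg : ℕ → Type*} [∀ k, NormedAddCommGroup (Cfg k)] [∀ k, NormedSpace ℂ (Cfg k)] {cfg : ∀ k, IOp → Cfg k}
    {Φ : ∀ k, (D.toTwoRuns.carriers.Dom → ℝ) → Cfg k → B13HistM P} {𝒪 : ℕ → (ℕ → ℝ) → D.toTwoRuns.carriers.BgB → Set IOp}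
    {Dc : ∀ k, (ℕ → ℝ) → D.toTwoRuns.carriers.BgB → Set (Cfg k)}
    -- the Letters module's §1 letter conditions (replace `hMA` ∕ `hMB`; `hbdB` about the SHIFTED raw record)
    (hbdA : ∀ (g : ℕ → ℝ) (U : D.carriers.BgA) (k : ℕ),
      FormatBounded (L.W k).format (rawAOfRecord ι D c a s L.ΓA L.dkA L.gcA L.pQA L.pRA g U k).kernel)
    (hmQA : ∀ (r : ℝ) (U : GaugeField (D.F.P D.K) 0 G) (k : ℕ) (Y : 𝒴) (b b' : ((Tor (unitMod (D.F.P D.K)) × Fin (D.F.P D.K).d) × o)),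
        Measurable fun x : Ω => L.pQA r U k x Y b b')
    (hmRA : ∀ (r : ℝ) (U : GaugeField (D.F.P D.K) 0 G) (k : ℕ) (Y : 𝒴), Measurable fun x : Ω => L.pRA r U k x Y)
    (hbdB : ∀ (g : ℕ → ℝ) (U : D.carriers.BgB) (k : ℕ),
      FormatBounded (L.W k).format (rawBOfRecordShift D ι c a s L.ΓB L.dkB L.gcB L.pQB L.pRB g U k).kernel)
    (hmQB : ∀ (r : ℝ) (U : GaugeField (D.F.P (D.K + 1)) 0 G) (k : ℕ) (Y : 𝒴) (b b' : ((Tor (unitMod (D.F.P D.K)) × Fin (D.F.P D.K).d) × o)),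
        Measurable fun x : Ω => L.pQB r U k x Y b b')
    (hmRB : ∀ (r : ℝ) (U : GaugeField (D.F.P (D.K + 1)) 0 G) (k : ℕ) (Y : 𝒴), Measurable fun x : Ω => L.pRB r U k x Y)
    -- the Letters module's §2 factorisation datum (replaces `hT`)
    (iopAt : ℝ → D.carriers.BgA → ℕ → IOp)
    (hiopA : ∀ (r : ℝ) (U : D.carriers.BgB) (k : ℕ), L.ins.iopA r U k = iopAt r (D.carriers.transport U) k)
    -- p217039 §3's binders VERBATIM at the shifted instance
    (hbB : (assembly (slotsOfRecordShift D ι c a s P 𝒵 dom Jc V mI L)).SliceBudgetB W κ cB)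
    (hbA : (slotsOfRecordShift D ι c a s P 𝒵 dom Jc V mI L).D.SliceBudget (step (slotsOfRecordShift D ι c a s P 𝒵 dom Jc V mI L) E₀ cB) W κ cA)
    (hdA : DecayBound (B13StepOfRecord.outA (slotsOfRecordShift D ι c a s P 𝒵 dom Jc V mI L) E₀ cB) W EA₀ κ)
    (hdB : DecayBound (B13StepOfRecord.outB (slotsOfRecordShift D ι c a s P 𝒵 dom Jc V mI L) E₀ cB) W E₀ κ)
    (hRA : RawBounded (slotsOfRecordShift D ι c a s P 𝒵 dom Jc V mI L).F (assembly (slotsOfRecordShift D ι c a s P 𝒵 dom Jc V mI L)).rawAt W)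
    (hRB : RawBounded (slotsOfRecordShift D ι c a s P 𝒵 dom Jc V mI L).F (slotsOfRecordShift D ι c a s P 𝒵 dom Jc V mI L).rawB W)
    (hwer : WeightedEntrywiseRate (slotsOfRecordShift D ι c a s P 𝒵 dom Jc V mI L).F (assembly (slotsOfRecordShift D ι c a s P 𝒵 dom Jc V mI L)).rawAt
      (slotsOfRecordShift D ι c a s P 𝒵 dom Jc V mI L).rawB W c₁
      fun k => θ ^ k) (hfl : ∀ k, r₀ ≤ L.rOp k)
    (hcomp : InsOpComposition ((slotsOfRecordShift D ι c a s P 𝒵 dom Jc V mI L).D.toInsOpModel (step (slotsOfRecordShift D ι c a s P 𝒵 dom Jc V mI L) E₀ cB)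
      rI hrI)
      W κ E₀ Gi cfg Φ 𝒪 Dc)
    (hIA : ∀ k, ∀ g ∈ W, ∀ (U : D.toTwoRuns.carriers.BgB),
      ((slotsOfRecordShift D ι c a s P 𝒵 dom Jc V mI L).D.toInsOpModel (step (slotsOfRecordShift D ι c a s P 𝒵 dom Jc V mI L) E₀ cB)
        rI hrI).opIA g U k ∈ 𝒪 k g U)
    (hirate : ((slotsOfRecordShift D ι c a s P 𝒵 dom Jc V mI L).D.toInsOpModel (step (slotsOfRecordShift D ι c a s P 𝒵 dom Jc V mI L) E₀ cB)
      rI hrI).InsOpRate W δI θ)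
    (hδI : 0 ≤ δI) (hGi : 0 ≤ Gi) (hρ₁ : ρ₁ < 1) (hreachI : δI * θ ^ k₁ ≤ ρ₁)
    (hfib : ActOpFibre (labelsIndexing (domainGeometry D.toTwoRuns) (b13InnerData D.toTwoRuns))
      (restrict (slotsOfRecordShift D ι c a s P 𝒵 dom Jc V mI L) (measOp T ((Tor (unitMod (D.F.P D.K)) × Fin (D.F.P D.K).d) × o) ι' Ω 𝒴)
          (opA_mem_measOp_slotsOfRecordShift D ι c a s P 𝒵 dom Jc V mI L hbdA hmQA hmRA)
        (opB_mem_measOp_slotsOfRecordShift D ι c a s P 𝒵 dom Jc V mI L hbdB hmQB hmRB)).act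
      (stepOn (restrict (slotsOfRecordShift D ι c a s P 𝒵 dom Jc V mI L) (measOp T ((Tor (unitMod (D.F.P D.K)) × Fin (D.F.P D.K).d) × o) ι' Ω 𝒴)
          (opA_mem_measOp_slotsOfRecordShift D ι c a s P 𝒵 dom Jc V mI L hbdA hmQA hmRA)
        (opB_mem_measOp_slotsOfRecordShift D ι c a s P 𝒵 dom Jc V mI L hbdB hmQB hmRB)) E₀ cB) W Aop)
    (hAop0 : ∀ k g U Z ℓ, 0 ≤ Aop k g U Z ℓ) (hAop0' : ∀ k g U Z ℓ, 0 ≤ Aop' k g U Z ℓ)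
    (hdecop : ∀ k g U Z ℓ, Aop k g U Z ℓ ≤ Aop' k g U Z ℓ * Real.exp (-(κ * (D.toTwoRuns.carriers.d Z + 5)))) (hεop : 0 ≤ εop)
    (h238op : ∀ k, ∀ g ∈ W, ∀ (U : D.toTwoRuns.carriers.BgB), ∀ Z ∈ D.toTwoRuns.domAt k,
      actSum (b13InnerData D.toTwoRuns) (Aop' k g U) k Z ≤ εop * Real.exp (-(Rt * D.toTwoRuns.carriers.d Z)))
    (hΦopsmall : 36 * (εop * Real.exp 64 * B12TreeDecay.K₀ (4 * 2 ^ 4) (2 * 4)) < 1)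
    (hexp : ActExpLinearOn (labelsIndexing (domainGeometry D.toTwoRuns) (b13InnerData D.toTwoRuns))
      (restrict (slotsOfRecordShift D ι c a s P 𝒵 dom Jc V mI L) (measOp T ((Tor (unitMod (D.F.P D.K)) × Fin (D.F.P D.K).d) × o) ι' Ω 𝒴)
          (opA_mem_measOp_slotsOfRecordShift D ι c a s P 𝒵 dom Jc V mI L hbdA hmQA hmRA)
        (opB_mem_measOp_slotsOfRecordShift D ι c a s P 𝒵 dom Jc V mI L hbdB hmQB hmRB)).act Dt
      (ballClass (selfCtr
        (assemblyOn (restrict (slotsOfRecordShift D ι c a s P 𝒵 dom Jc V mI L) (measOp T ((Tor (unitMod (D.F.P D.K)) × Fin (D.F.P D.K).d) × o) ι' Ω 𝒴)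
            (opA_mem_measOp_slotsOfRecordShift D ι c a s P 𝒵 dom Jc V mI L hbdA hmQA hmRA)
          (opB_mem_measOp_slotsOfRecordShift D ι c a s P 𝒵 dom Jc V mI L hbdB hmQB hmRB))).raw
        (assemblyOn (restrict (slotsOfRecordShift D ι c a s P 𝒵 dom Jc V mI L) (measOp T ((Tor (unitMod (D.F.P D.K)) × Fin (D.F.P D.K).d) × o) ι' Ω 𝒴)
            (opA_mem_measOp_slotsOfRecordShift D ι c a s P 𝒵 dom Jc V mI L hbdA hmQA hmRA)
          (opB_mem_measOp_slotsOfRecordShift D ι c a s P 𝒵 dom Jc V mI L hbdB hmQB hmRB))).histRef) ROp RHist) W)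
    (hN : ActExpNormBound (labelsIndexing (domainGeometry D.toTwoRuns) (b13InnerData D.toTwoRuns)) Dt
      (ballClass (selfCtr
        (assemblyOn (restrict (slotsOfRecordShift D ι c a s P 𝒵 dom Jc V mI L) (measOp T ((Tor (unitMod (D.F.P D.K)) × Fin (D.F.P D.K).d) × o) ι' Ω 𝒴)
            (opA_mem_measOp_slotsOfRecordShift D ι c a s P 𝒵 dom Jc V mI L hbdA hmQA hmRA)
          (opB_mem_measOp_slotsOfRecordShift D ι c a s P 𝒵 dom Jc V mI L hbdB hmQB hmRB))).raw
        (assemblyOn (restrict (slotsOfRecordShift D ι c a s P 𝒵 dom Jc V mI L) (measOp T ((Tor (unitMod (D.F.P D.K)) × Fin (D.F.P D.K).d) × o) ι' Ω 𝒴)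
            (opA_mem_measOp_slotsOfRecordShift D ι c a s P 𝒵 dom Jc V mI L hbdA hmQA hmRA)
          (opB_mem_measOp_slotsOfRecordShift D ι c a s P 𝒵 dom Jc V mI L hbdB hmQB hmRB))).histRef) ROp RHist) W
      L.rHist N)
    (hN0 : ∀ k g U Z ℓ, 0 ≤ N k g U Z ℓ) (hNle : ∀ k g U Z ℓ, N k g U Z ℓ ≤ Nbar) (hNbar : 0 ≤ Nbar)
    (habs : ActAbsBound (labelsIndexing (domainGeometry D.toTwoRuns) (b13InnerData D.toTwoRuns)) Dt
      (ballClass (selfCtr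
        (assemblyOn (restrict (slotsOfRecordShift D ι c a s P 𝒵 dom Jc V mI L) (measOp T ((Tor (unitMod (D.F.P D.K)) × Fin (D.F.P D.K).d) × o) ι' Ω 𝒴)
            (opA_mem_measOp_slotsOfRecordShift D ι c a s P 𝒵 dom Jc V mI L hbdA hmQA hmRA)
          (opB_mem_measOp_slotsOfRecordShift D ι c a s P 𝒵 dom Jc V mI L hbdB hmQB hmRB))).raw
        (assemblyOn (restrict (slotsOfRecordShift D ι c a s P 𝒵 dom Jc V mI L) (measOp T ((Tor (unitMod (D.F.P D.K)) × Fin (D.F.P D.K).d) × o) ι' Ω 𝒴)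
            (opA_mem_measOp_slotsOfRecordShift D ι c a s P 𝒵 dom Jc V mI L hbdA hmQA hmRA)
          (opB_mem_measOp_slotsOfRecordShift D ι c a s P 𝒵 dom Jc V mI L hbdB hmQB hmRB))).histRef) ROp RHist) W A)
    (hA0 : ∀ k g U Z ℓ, 0 ≤ A k g U Z ℓ) (hA0' : ∀ k g U Z ℓ, 0 ≤ A' k g U Z ℓ) (hκ : 0 ≤ κ)
    (hdec : ∀ k g U Z ℓ, A k g U Z ℓ ≤ A' k g U Z ℓ * Real.exp (-(κ * (D.toTwoRuns.carriers.d Z + 5))))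
    (hε : 0 ≤ ε)
    (h238 : ∀ k, ∀ g ∈ W, ∀ (U : D.toTwoRuns.carriers.BgB), ∀ Z ∈ D.toTwoRuns.domAt k,
      actSum (b13InnerData D.toTwoRuns) (A' k g U) k Z ≤ ε * Real.exp (-(Rt * D.toTwoRuns.carriers.d Z)))
    (hRt : 64 * Real.log 162 + 64 ≤ Rt) (hΦsmall : 36 * (ε * Real.exp 64 * B12TreeDecay.K₀ (4 * 2 ^ 4) (2 * 4)) < 1)
    (hOp : ∀ k, c₁ / r₀ * L.rOp k ≤ ROp k) (hHist : ∀ k, (assembly (slotsOfRecordShift D ι c a s P 𝒵 dom Jc V mI L)).bHist E₀ cB k ≤ RHist k)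
    (hHistA : ∀ k, (Gi * δI / (1 - ρ₁) + 2 * Gi / θ ^ k₁) * L.rHist k + EA₀ * (L.rHist k * (cA / (1 - L.ins.ω))) ≤ RHist k)
    (hEA₀ : 0 ≤ EA₀) (hE₀ : 0 ≤ E₀) (hE₁ : 0 < E₁) (hcA : 0 ≤ cA) (hcB : 0 ≤ cB)
    (hc₁ : 0 ≤ c₁) (hr₀ : 0 < r₀) (hθ0 : 0 < θ) (hθθ' : θ ≤ θ') (hθ'1 : θ' ≤ 1) (hω : 0 < L.ins.ω)
    (hω1 : L.ins.ω < 1) (hρ₀ : 0 ≤ ρ₀) (hρ₀1 : ρ₀ < 1) (hreach : c₁ / r₀ * θ ^ k₀ ≤ ρ₀) (hB : 0 ≤ B)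
    (hfirst : ∀ k < k₀, EA₀ + E₀ ≤ B * θ ^ k)
    (hsmall : L.ins.ω + 2 * (Nbar * ((ε * Real.exp 64 * B12TreeDecay.K₀ (4 * 2 ^ 4) (2 * 4)) /
          (1 - 36 * (ε * Real.exp 64 * B12TreeDecay.K₀ (4 * 2 ^ 4) (2 * 4))) ^ 2)) * cA < θ') :
    NE5 (B13StepOfRecord.outA (slotsOfRecordShift D ι c a s P 𝒵 dom Jc V mI L) E₀ cB)
      (B13StepOfRecord.outB (slotsOfRecordShift D ι c a s P 𝒵 dom Jc V mI L) E₀ cB) W κ θ'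
      (((1 / (1 - ρ₀) * ((εop * Real.exp 64 * B12TreeDecay.K₀ (4 * 2 ^ 4) (2 * 4)) /
          (1 - 36 * (εop * Real.exp 64 * B12TreeDecay.K₀ (4 * 2 ^ 4) (2 * 4))) ^ 2)) * (c₁ / r₀) +
        2 * (Nbar * ((ε * Real.exp 64 * B12TreeDecay.K₀ (4 * 2 ^ 4) (2 * 4)) /
          (1 - 36 * (ε * Real.exp 64 * B12TreeDecay.K₀ (4 * 2 ^ 4) (2 * 4))) ^ 2)) *
          (Gi * δI / (1 - ρ₁) + 2 * Gi / θ ^ k₁) + B) * (θ' - L.ins.ω) /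
        (θ' - (L.ins.ω + 2 * (Nbar * ((ε * Real.exp 64 * B12TreeDecay.K₀ (4 * 2 ^ 4) (2 * 4)) /
          (1 - 36 * (ε * Real.exp 64 * B12TreeDecay.K₀ (4 * 2 ^ 4) (2 * 4))) ^ 2)) * cA))) :=
  ne5_of_record_restrict_secant_structural (slotsOfRecordShift D ι c a s P 𝒵 dom Jc V mI L)
    (measOp T ((Tor (unitMod (D.F.P D.K)) × Fin (D.F.P D.K).d) × o) ι' Ω 𝒴)
    (opA_mem_measOp_slotsOfRecordShift D ι c a s P 𝒵 dom Jc V mI L hbdA hmQA hmRA)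
    (opB_mem_measOp_slotsOfRecordShift D ι c a s P 𝒵 dom Jc V mI L hbdB hmQB hmRB) E₀ cB rI hrI
    (transportReads_slotsOfRecordShift_of_factor D ι c a s P 𝒵 dom Jc V mI L iopAt hiopA W) hbB hbA hdA hdB hRA hRB
    hwer hfl hcomp hIA hirate hδI hGi hρ₁ hreachI hfib hAop0 hAop0' hdecop hεop h238op hΦopsmall hexp hN hN0 hNle hNbar habs hA0 hA0' hκ
    hdec hε h238 hRt hΦsmall hOp hHist hHistA hEA₀ hE₀ hE₁ hcA hcB hc₁ hr₀ hθ0 hθθ' hθ'1 hω hω1 hρ₀ hρ₀1 hreach hB hfirst hsmall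

end Instance
end Shifted

/-! ## §2 The η-uniform form at the shifted instance: one constant for every driven two-run object and every letter package -/

/-- [folklore] **E8[rec] AT THE SUBSTRATE's COV-SHIFTED O1 INSTANCE WITH A CONSTANT UNIFORM IN THE PAIR OF RUNS AND THE LETTERS** (p219431 §2
`uniform_ne5_of_record_restrict_secant_structural` at the shifted instance; = p221190 §4 with `slotsOfRecord ↦ slotsOfRecordShift`).  Fix the displayed
SIZES exactly as there; then ONE constant `C₅` serves EVERY driven two-run object `D : DrivenRuns G`, representation `ι`, letters `c a s`, frame `P`,
factor index data `𝒵 dom Jc V mI`, EVERY letter package `L : SlotLetters …` with `L.ins.ω = ω` satisfying the Letters module's six letter conditions and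
its factorisation, and every window ∕ radii ∕ majorants ∕ datum ∕ insertion-composition data: §1's displayed binders IMPLY
`NE5 (B13StepOfRecord.outA (slotsOfRecordShift …) E₀ cB) (B13StepOfRecord.outB (slotsOfRecordShift …) E₀ cB) W κ θ′ C₅` (quantifier order
`∃ C₅, ∀ D … L W …`).  NOT a proof of NE5: an implication from displayed binders about the substrate's letters at the shifted slots. -/
theorem uniform_ne5_of_substrateShift_restrict_secant_structural {κ Nbar ε εop Rt EA₀ E₀ cA cB c₁ r₀ Gi δI ρ₁ θ θ' ω ρ₀ : ℝ} {k₁ : ℕ}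
    (hκ : 0 ≤ κ) (hNbar : 0 ≤ Nbar) (hε : 0 ≤ ε) (hεop : 0 ≤ εop) (hRt : 64 * Real.log 162 + 64 ≤ Rt)
    (hΦsmall : 36 * (ε * Real.exp 64 * B12TreeDecay.K₀ (4 * 2 ^ 4) (2 * 4)) < 1)
    (hΦopsmall : 36 * (εop * Real.exp 64 * B12TreeDecay.K₀ (4 * 2 ^ 4) (2 * 4)) < 1)
    (hEA₀ : 0 ≤ EA₀) (hE₀ : 0 ≤ E₀) (hcA : 0 ≤ cA) (hcB : 0 ≤ cB) (hc₁ : 0 ≤ c₁) (hr₀ : 0 < r₀)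
    (hGi : 0 ≤ Gi) (hδI : 0 ≤ δI) (hρ₁ : ρ₁ < 1) (hreachI : δI * θ ^ k₁ ≤ ρ₁)
    (hθ0 : 0 < θ) (hθ1 : θ < 1) (hθθ' : θ ≤ θ') (hθ'1 : θ' ≤ 1) (hω : 0 < ω) (hω1 : ω < 1) (hρ₀ : 0 < ρ₀) (hρ₀1 : ρ₀ < 1)
    (hsmall : ω + 2 * (Nbar * ((ε * Real.exp 64 * B12TreeDecay.K₀ (4 * 2 ^ 4) (2 * 4)) /
          (1 - 36 * (ε * Real.exp 64 * B12TreeDecay.K₀ (4 * 2 ^ 4) (2 * 4))) ^ 2)) * cA < θ') :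
    ∃ C₅ : ℝ, ∀ {G : Type} [GaugeGroup G] (D : DrivenRuns G) {o : Type} [Fintype o] [DecidableEq o] (ι : G →* Matrix o o ℂ) (c : ℂ)
      (a : ℝ) (s : ℕ → ℂ) {T ι' S Ω 𝒴 : Type} [MeasurableSpace Ω] (P : MeasPotFrame D.carriers) {IOp : Type*} [NormedAddCommGroup IOp]
      [NormedSpace ℂ IOp] (𝒵 : D.carriers.Dom → InnerLabel D.carriers.Dom (Bnd D.toTwoRuns) → Type) [∀ Z j, Fintype (𝒵 Z j)]
      (dom : ∀ Z j, 𝒵 Z j → D.carriers.Dom) (Jc : D.carriers.Dom → InnerLabel D.carriers.Dom (Bnd D.toTwoRuns) → Type)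
      [∀ Z j, Fintype (Jc Z j)] (V : D.carriers.Dom → InnerLabel D.carriers.Dom (Bnd D.toTwoRuns) → Type)
      [∀ Z j, NormedAddCommGroup (V Z j)] [∀ Z j, InnerProductSpace ℝ (V Z j)] [∀ Z j, MeasurableSpace (V Z j)] [∀ Z j, BorelSpace (V Z j)]
      [∀ Z j, FiniteDimensional ℝ (V Z j)] (mI : D.carriers.Dom → InnerLabel D.carriers.Dom (Bnd D.toTwoRuns) → Type)
      [∀ Z j, Fintype (mI Z j)] [∀ Z j, DecidableEq (mI Z j)]
      (L : SlotLetters D (o := o) (T := T) (ι' := ι') (S := S) (Ω := Ω) (𝒴 := 𝒴) P (IOp := IOp) 𝒵 dom Jc V mI)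
      (hbdA : ∀ (g : ℕ → ℝ) (U : D.carriers.BgA) (k : ℕ),
        FormatBounded (L.W k).format (rawAOfRecord ι D c a s L.ΓA L.dkA L.gcA L.pQA L.pRA g U k).kernel)
      (hmQA : ∀ (r : ℝ) (U : GaugeField (D.F.P D.K) 0 G) (k : ℕ) (Y : 𝒴) (b b' : ((Tor (unitMod (D.F.P D.K)) × Fin (D.F.P D.K).d) × o)),
        Measurable fun x : Ω => L.pQA r U k x Y b b')
      (hmRA : ∀ (r : ℝ) (U : GaugeField (D.F.P D.K) 0 G) (k : ℕ) (Y : 𝒴), Measurable fun x : Ω => L.pRA r U k x Y)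
      (hbdB : ∀ (g : ℕ → ℝ) (U : D.carriers.BgB) (k : ℕ),
        FormatBounded (L.W k).format (rawBOfRecordShift D ι c a s L.ΓB L.dkB L.gcB L.pQB L.pRB g U k).kernel)
      (hmQB : ∀ (r : ℝ) (U : GaugeField (D.F.P (D.K + 1)) 0 G) (k : ℕ) (Y : 𝒴) (b b' : ((Tor (unitMod (D.F.P D.K)) × Fin (D.F.P D.K).d) × o)),
        Measurable fun x : Ω => L.pQB r U k x Y b b')
      (hmRB : ∀ (r : ℝ) (U : GaugeField (D.F.P (D.K + 1)) 0 G) (k : ℕ) (Y : 𝒴), Measurable fun x : Ω => L.pRB r U k x Y)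
      (iopAt : ℝ → D.carriers.BgA → ℕ → IOp)
      (hiopA : ∀ (r : ℝ) (U : D.carriers.BgB) (k : ℕ), L.ins.iopA r U k = iopAt r (D.carriers.transport U) k)
      {W : Set (ℕ → ℝ)} {ROp RHist : ℕ → ℝ}
      {N A A' Aop Aop' : ℕ → (ℕ → ℝ) → D.toTwoRuns.carriers.BgB → D.toTwoRuns.carriers.Dom →
        InnerLabel D.toTwoRuns.carriers.Dom (Bnd D.toTwoRuns) → ℝ}
      {Dt : ActData D.toTwoRuns.carriers.Dom (InnerLabel D.toTwoRuns.carriers.Dom (Bnd D.toTwoRuns))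
        (measOp T ((Tor (unitMod (D.F.P D.K)) × Fin (D.F.P D.K).d) × o) ι' Ω 𝒴) (B13HistM P) Ω} {rI : ℕ → ℝ} {hrI : ∀ k, 0 < rI k}
      {Cfg : ℕ → Type*} [∀ k, NormedAddCommGroup (Cfg k)] [∀ k, NormedSpace ℂ (Cfg k)] {cfg : ∀ k, IOp → Cfg k}
      {Φ : ∀ k, (D.toTwoRuns.carriers.Dom → ℝ) → Cfg k → B13HistM P} {𝒪 : ℕ → (ℕ → ℝ) → D.toTwoRuns.carriers.BgB → Set IOp}
      {Dc : ∀ k, (ℕ → ℝ) → D.toTwoRuns.carriers.BgB → Set (Cfg k)},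
      L.ins.ω = ω →
      (assembly (slotsOfRecordShift D ι c a s P 𝒵 dom Jc V mI L)).SliceBudgetB W κ cB →
      (slotsOfRecordShift D ι c a s P 𝒵 dom Jc V mI L).D.SliceBudget (step (slotsOfRecordShift D ι c a s P 𝒵 dom Jc V mI L) E₀ cB) W κ cA →
      DecayBound (B13StepOfRecord.outA (slotsOfRecordShift D ι c a s P 𝒵 dom Jc V mI L) E₀ cB) W EA₀ κ →
      DecayBound (B13StepOfRecord.outB (slotsOfRecordShift D ι c a s P 𝒵 dom Jc V mI L) E₀ cB) W E₀ κ →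
      RawBounded (slotsOfRecordShift D ι c a s P 𝒵 dom Jc V mI L).F (assembly (slotsOfRecordShift D ι c a s P 𝒵 dom Jc V mI L)).rawAt W →
      RawBounded (slotsOfRecordShift D ι c a s P 𝒵 dom Jc V mI L).F (slotsOfRecordShift D ι c a s P 𝒵 dom Jc V mI L).rawB W →
      WeightedEntrywiseRate (slotsOfRecordShift D ι c a s P 𝒵 dom Jc V mI L).F (assembly (slotsOfRecordShift D ι c a s P 𝒵 dom Jc V mI L)).rawAt
          (slotsOfRecordShift D ι c a s P 𝒵 dom Jc V mI L).rawB W c₁ (fun k => θ ^ k) → (∀ k, r₀ ≤ L.rOp k) →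
      InsOpComposition ((slotsOfRecordShift D ι c a s P 𝒵 dom Jc V mI L).D.toInsOpModel (step (slotsOfRecordShift D ι c a s P 𝒵 dom Jc V mI L) E₀ cB) rI hrI)
          W κ E₀ Gi cfg Φ 𝒪 Dc →
      (∀ k, ∀ g ∈ W, ∀ (U : D.toTwoRuns.carriers.BgB),
        ((slotsOfRecordShift D ι c a s P 𝒵 dom Jc V mI L).D.toInsOpModel (step (slotsOfRecordShift D ι c a s P 𝒵 dom Jc V mI L) E₀ cB)
          rI hrI).opIA g U k ∈ 𝒪 k g U) →
      ((slotsOfRecordShift D ι c a s P 𝒵 dom Jc V mI L).D.toInsOpModel (step (slotsOfRecordShift D ι c a s P 𝒵 dom Jc V mI L) E₀ cB) rI hrI).InsOpRate W δI θ →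
      ActOpFibre (labelsIndexing (domainGeometry D.toTwoRuns) (b13InnerData D.toTwoRuns))
        (restrict (slotsOfRecordShift D ι c a s P 𝒵 dom Jc V mI L) (measOp T ((Tor (unitMod (D.F.P D.K)) × Fin (D.F.P D.K).d) × o) ι' Ω 𝒴)
          (opA_mem_measOp_slotsOfRecordShift D ι c a s P 𝒵 dom Jc V mI L hbdA hmQA hmRA) (opB_mem_measOp_slotsOfRecordShift D ι c a s P 𝒵 dom Jc V mI L hbdB
            hmQB hmRB)).act
        (stepOn (restrict (slotsOfRecordShift D ι c a s P 𝒵 dom Jc V mI L) (measOp T ((Tor (unitMod (D.F.P D.K)) × Fin (D.F.P D.K).d) × o) ι' Ω 𝒴)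
          (opA_mem_measOp_slotsOfRecordShift D ι c a s P 𝒵 dom Jc V mI L hbdA hmQA hmRA) (opB_mem_measOp_slotsOfRecordShift D ι c a s P 𝒵 dom Jc V mI L hbdB
            hmQB hmRB)) E₀ cB) W Aop →
      (∀ k g U Z ℓ, 0 ≤ Aop k g U Z ℓ) → (∀ k g U Z ℓ, 0 ≤ Aop' k g U Z ℓ) →
      (∀ k g U Z ℓ, Aop k g U Z ℓ ≤ Aop' k g U Z ℓ * Real.exp (-(κ * (D.toTwoRuns.carriers.d Z + 5)))) →
      (∀ k, ∀ g ∈ W, ∀ (U : D.toTwoRuns.carriers.BgB), ∀ Z ∈ D.toTwoRuns.domAt k,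
        actSum (b13InnerData D.toTwoRuns) (Aop' k g U) k Z ≤ εop * Real.exp (-(Rt * D.toTwoRuns.carriers.d Z))) →
      ActExpLinearOn (labelsIndexing (domainGeometry D.toTwoRuns) (b13InnerData D.toTwoRuns))
        (restrict (slotsOfRecordShift D ι c a s P 𝒵 dom Jc V mI L) (measOp T ((Tor (unitMod (D.F.P D.K)) × Fin (D.F.P D.K).d) × o) ι' Ω 𝒴)
          (opA_mem_measOp_slotsOfRecordShift D ι c a s P 𝒵 dom Jc V mI L hbdA hmQA hmRA) (opB_mem_measOp_slotsOfRecordShift D ι c a s P 𝒵 dom Jc V mI L hbdB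
            hmQB hmRB)).act Dt
        (ballClass (selfCtr
          (assemblyOn (restrict (slotsOfRecordShift D ι c a s P 𝒵 dom Jc V mI L) (measOp T ((Tor (unitMod (D.F.P D.K)) × Fin (D.F.P D.K).d) × o) ι' Ω 𝒴)
            (opA_mem_measOp_slotsOfRecordShift D ι c a s P 𝒵 dom Jc V mI L hbdA hmQA hmRA) (opB_mem_measOp_slotsOfRecordShift D ι c a s P 𝒵 dom Jc V mI L hbdB
              hmQB hmRB))).raw
          (assemblyOn (restrict (slotsOfRecordShift D ι c a s P 𝒵 dom Jc V mI L) (measOp T ((Tor (unitMod (D.F.P D.K)) × Fin (D.F.P D.K).d) × o) ι' Ω 𝒴)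
            (opA_mem_measOp_slotsOfRecordShift D ι c a s P 𝒵 dom Jc V mI L hbdA hmQA hmRA) (opB_mem_measOp_slotsOfRecordShift D ι c a s P 𝒵 dom Jc V mI L hbdB
              hmQB hmRB))).histRef) ROp RHist) W →
      ActExpNormBound (labelsIndexing (domainGeometry D.toTwoRuns) (b13InnerData D.toTwoRuns)) Dt
        (ballClass (selfCtr
          (assemblyOn (restrict (slotsOfRecordShift D ι c a s P 𝒵 dom Jc V mI L) (measOp T ((Tor (unitMod (D.F.P D.K)) × Fin (D.F.P D.K).d) × o) ι' Ω 𝒴)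
            (opA_mem_measOp_slotsOfRecordShift D ι c a s P 𝒵 dom Jc V mI L hbdA hmQA hmRA) (opB_mem_measOp_slotsOfRecordShift D ι c a s P 𝒵 dom Jc V mI L hbdB
              hmQB hmRB))).raw
          (assemblyOn (restrict (slotsOfRecordShift D ι c a s P 𝒵 dom Jc V mI L) (measOp T ((Tor (unitMod (D.F.P D.K)) × Fin (D.F.P D.K).d) × o) ι' Ω 𝒴)
            (opA_mem_measOp_slotsOfRecordShift D ι c a s P 𝒵 dom Jc V mI L hbdA hmQA hmRA) (opB_mem_measOp_slotsOfRecordShift D ι c a s P 𝒵 dom Jc V mI L hbdB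
              hmQB hmRB))).histRef) ROp RHist) W
        L.rHist N →
      (∀ k g U Z ℓ, 0 ≤ N k g U Z ℓ) → (∀ k g U Z ℓ, N k g U Z ℓ ≤ Nbar) →
      ActAbsBound (labelsIndexing (domainGeometry D.toTwoRuns) (b13InnerData D.toTwoRuns)) Dt
        (ballClass (selfCtr
          (assemblyOn (restrict (slotsOfRecordShift D ι c a s P 𝒵 dom Jc V mI L) (measOp T ((Tor (unitMod (D.F.P D.K)) × Fin (D.F.P D.K).d) × o) ι' Ω 𝒴)
            (opA_mem_measOp_slotsOfRecordShift D ι c a s P 𝒵 dom Jc V mI L hbdA hmQA hmRA) (opB_mem_measOp_slotsOfRecordShift D ι c a s P 𝒵 dom Jc V mI L hbdB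
              hmQB hmRB))).raw
          (assemblyOn (restrict (slotsOfRecordShift D ι c a s P 𝒵 dom Jc V mI L) (measOp T ((Tor (unitMod (D.F.P D.K)) × Fin (D.F.P D.K).d) × o) ι' Ω 𝒴)
            (opA_mem_measOp_slotsOfRecordShift D ι c a s P 𝒵 dom Jc V mI L hbdA hmQA hmRA) (opB_mem_measOp_slotsOfRecordShift D ι c a s P 𝒵 dom Jc V mI L hbdB
              hmQB hmRB))).histRef) ROp RHist) W A →
      (∀ k g U Z ℓ, 0 ≤ A k g U Z ℓ) → (∀ k g U Z ℓ, 0 ≤ A' k g U Z ℓ) →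
      (∀ k g U Z ℓ, A k g U Z ℓ ≤ A' k g U Z ℓ * Real.exp (-(κ * (D.toTwoRuns.carriers.d Z + 5)))) →
      (∀ k, ∀ g ∈ W, ∀ (U : D.toTwoRuns.carriers.BgB), ∀ Z ∈ D.toTwoRuns.domAt k,
        actSum (b13InnerData D.toTwoRuns) (A' k g U) k Z ≤ ε * Real.exp (-(Rt * D.toTwoRuns.carriers.d Z))) →
      (∀ k, c₁ / r₀ * L.rOp k ≤ ROp k) → (∀ k, (assembly (slotsOfRecordShift D ι c a s P 𝒵 dom Jc V mI L)).bHist E₀ cB k ≤ RHist k) →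
      (∀ k, (Gi * δI / (1 - ρ₁) + 2 * Gi / θ ^ k₁) * L.rHist k + EA₀ * (L.rHist k * (cA / (1 - ω))) ≤ RHist k) →
      NE5 (B13StepOfRecord.outA (slotsOfRecordShift D ι c a s P 𝒵 dom Jc V mI L) E₀ cB)
        (B13StepOfRecord.outB (slotsOfRecordShift D ι c a s P 𝒵 dom Jc V mI L) E₀ cB) W κ θ' C₅ := by
  obtain ⟨C₅, h⟩ := uniform_ne5_of_record_restrict_secant_structural (k₁ := k₁) hκ hNbar hε hεop hRt hΦsmall hΦopsmall hEA₀ hE₀ hcA hcB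
    hc₁ hr₀ hGi hδI hρ₁ hreachI hθ0 hθ1 hθθ' hθ'1 hω hω1 hρ₀ hρ₀1 hsmall
  refine ⟨C₅, ?_⟩
  intro G _ D o _ _ ι c a s T ι' S Ω 𝒴 _ P IOp _ _ 𝒵 _ dom Jc _ V _ _ _ _ _ mI _ _ L hbdA hmQA hmRA hbdB hmQB hmRB iopAt hiopA W ROp RHist N A
    A' Aop Aop' Dt rI hrI Cfg _ _ cfg Φ 𝒪 Dc hLω hbB hbA hdA hdB hRA hRB hwer hfl hcomp hIA hirate hfib hAop0 hAop0' hdecop h238op hexp hN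
    hN0 hNle habs hA0 hA0' hdec h238 hOp hHist hHistA
  exact h (slotsOfRecordShift D ι c a s P 𝒵 dom Jc V mI L) (measOp T ((Tor (unitMod (D.F.P D.K)) × Fin (D.F.P D.K).d) × o) ι' Ω 𝒴)
    (opA_mem_measOp_slotsOfRecordShift D ι c a s P 𝒵 dom Jc V mI L hbdA hmQA hmRA)
    (opB_mem_measOp_slotsOfRecordShift D ι c a s P 𝒵 dom Jc V mI L hbdB hmQB hmRB) hLω
    (transportReads_slotsOfRecordShift_of_factor D ι c a s P 𝒵 dom Jc V mI L iopAt hiopA W) hbB hbA hdA hdB hRA hRB hwer hfl hcomp hIA hirate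
    hfib hAop0 hAop0' hdecop h238op hexp hN hN0 hNle habs hA0 hA0' hdec h238 hOp hHist hHistA

end Summit.QuantumFields.BalabanUV.T4Continuum.B13StepOfRecordSubstrateShift

end
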